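import Summits.BirchSwinnertonDyer.BirchSwinnertonDyer.Theses.CyclotomicUntwist
import Summits.BirchSwinnertonDyer.BirchSwinnertonDyer.Theses.SemiOrdinaryEisensteinDescent
import Summits.BirchSwinnertonDyer.BirchSwinnertonDyer.Theorems.CyclotomicUntwistPSRankOneLowerHalfAtThreeOfSOED
import Summits.BirchSwinnertonDyer.BirchSwinnertonDyer.Theorems.SemiOrdinaryEisensteinDescentEisensteinKernelAtThreeRestrictedOfControlLe
import HarnessLib

/-!
# Route `CyclotomicUntwist`, deciding crux K1 `PSRankOneLowerHalfAtThree` (stmt-BirchSwinnertonDyer-21580) BY NAME from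
# route SOED's CRUX OF RECORD E′ `WildSplitEisensteinInclusionAtThreeRestricted` (24155) and the CHEAPENED suppliers of the
# shared cruxes #4/#5 — {LZZ, one `R₀`-frame at odd `d_K`} and {PT1} — plus the rank-zero wild leaf Z
# (cell `pub/bsd-wall`, width seat `bsd-wall-soed-p1-w3` g6, `--supports stmt-BirchSwinnertonDyer-21580`, helper)

WHY. The cross-route kernel `CyclotomicUntwistOfSOED.psRankOneLowerHalfAtThree_of_soed` (cycu-p3 g0) reads CU's K1 as
`K1 ⊆ SOED {E, V, C, Z}` — but E (`WildSplitEisensteinInclusionAtThree`, 20479) is ASIDE since SOED rev 6–8 (pen pss3x,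
2026-08-28T00:36Z): SOED's crux of record is the RESTRICTED crux E′ (24155), and the shared cruxes #4 (V) / #5 (C) are being
moved out of the open-crux cone (pen PLAN (B) 01:37Z: #4 at odd `d_K` = print + port; utd-p3 g6 01:34Z: #5's `≤` half ⟸ PT1
alone). This file re-keys the CU supply accordingly, exactly as the companions
`…EisensteinKernelAtThreeRestrictedOfFrameOdd` (p594734) and `…RestrictedOfControlLe` (p595286) re-key SOED's own kernel:
* E′ suffices: the Eisenstein step is taken at the Friedberg–Hoffstein field, where its extra binders `(H, ι, P)`,
  `L(E^{(d_K)},1) ≠ 0`, `P = y_K`, `¬ IsOfFinAddOrder P` are in hand;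
* crux #4 is consumed once, as frame + unit value at that field (`d_K ≡ 1 (mod 8)` odd) — displayed supplier `hVodd`;
* crux #5 is consumed once, through the STEP L link for the LOWER socket only — as the INEQUALITY
  `SchneiderFreeControlAtoms.AdditiveControlLeOnTreeAt … 0 P` (utd-p3 g6's `≤`-link, p593079 §3) — displayed supplier `hCle`.
The lower half needs NO tower binder, NO Kolyvagin crux Ko and NO residual NT (as in the cycu-p3 file).

CONTENTS (0 definitions, 0 named facts, 0 `sorry`; every crux / input is an ANTECEDENT):
* §1 CORE `lowerHalf_of_restricted_of_valueOdd_of_controlLe_of_rankZeroLeaf`: PUB ∧ E′ ∧ hVodd ∧ hCle ∧ Z ⟹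
  `MissingLowerBoundAt W 3` for EVERY globally minimal `W` on `ClassO6 W 3` with `ρ̄_{E,3}` onto and `r_an = 1` — cycu-p3 g0's §1
  VERBATIM except: Eisenstein step fed by E′ with the datum; step (b) from `hVodd`; the link with `≤`.
* §2 K1 BY NAME, three feeds (the feed lemmas are p595286 §2): `psRankOneLowerHalfAtThree_of_restricted_of_waldspurger_of_control`
  (PUB, E′, V, C, Z — the pure E ↦ E′ re-key), `…_of_restricted_of_waldspurger_of_poitouTate` (PUB, E′, V, PT1, Z),
  `…_of_restricted_of_frameOdd_of_poitouTate` (PUB, E′, LZZ, [frame at odd d_K: item 20928's text + Odd (discr K)], PT1, Z).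

HONEST FRAMING: a CONDITIONAL cross-route kernel; closes nothing; K1's own finite-slope thesis is untouched; E′ has no engine
(walls W1–W3); BSD₃ is proved for no curve.

References: [JetchevSkinnerWan2017] Thm. 3.3.1, §7.4.1 (arXiv:1512.06894 pp. 11, 30); [Castella2018] Thm. 2.3, §5;
[GrossZagier1986] Thm. I.(6.3), V.§2; [FriedbergHoffstein1995] Thm. B; [LiuZhangZhang2018] Thm 1.5.1/1.5.3; [MilneADT2006]
I Thm. 4.10(b); [Miller2011LMS] Def. 1.1; [Zywina2015] Prop. 1.14/1.16.
-/

noncomputable section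

open scoped Classical

set_option linter.dupNamespace false
set_option autoImplicit false

namespace Summit.BirchSwinnertonDyer.BirchSwinnertonDyer.Theorems.CyclotomicUntwistOfSOEDRestricted

open WeierstrassCurve NumberField IsDedekindDomain Field
  Literature.NumberTheory.EllipticCurves
  Literature.NumberTheory.EllipticCurves.ModularForms
  Literature.NumberTheory.EllipticCurves.LiuZhangZhang2018
  Literature.NumberTheory.EllipticCurves.Rank1Residual
  Literature.NumberTheory.EllipticCurves.Rank1Residual.Typed
  Literature.NumberTheory.EllipticCurves.KrizLi2019
  Summit.BirchSwinnertonDyer.Rank1Residual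
  Summit.BirchSwinnertonDyer.Rank1Residual.Additive
  Summit.BirchSwinnertonDyer.Rank1Residual.X11b
  Summit.BirchSwinnertonDyer.Rank1Residual.X11b.AcSelmer
  Summit.BirchSwinnertonDyer.Rank1Residual.X11b.Halves
  Summit.BirchSwinnertonDyer.BirchSwinnertonDyer.Theses.SemiOrdinaryEisensteinDescent
  Summit.BirchSwinnertonDyer.BirchSwinnertonDyer.Theorems
  Summit.BirchSwinnertonDyer.BirchSwinnertonDyer.Theorems.CyclotomicUntwistOfSOED
  Summit.BirchSwinnertonDyer.BirchSwinnertonDyer.Theorems.EisensteinKernelAtThreeRestrictedOfControlLe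

/-! ### §1 CORE: the LOWER half on every onto wild rank-one row from E′, the two displayed suppliers and Z -/

/-- **The Iwasawa-side LOWER half `MissingLowerBoundAt W 3` on the whole onto wild rank-one leaf from PUB ∧ E′ ∧ hVodd ∧
hCle ∧ Z** (`hVodd` = crux #4's text with `Odd (NumberField.discr K)` inserted after the Heegner binder; `hCle` = crux #5's
text with conclusion the control INEQUALITY at slack `0`). Steps: parity; Friedberg–Hoffstein with modulus `2` (odd `d_K`);
Heegner point, Gross–Zagier, Kolyvagin for the datum; frame `(κ, γ, 𝔭, 𝔭′)`; value at `𝔭` from `hVodd`; `≤`-control at `𝔭′`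
from `hCle`; the RESTRICTED Eisenstein inclusion (E′ BY NAME, fed with the datum) ⟹ T-B6-1 at slack `v₃(c)`; `≤`-link
(p593079) ⟹ STEP L; JOINT lower half over `(E, E^{d_K})` (kmc g17); Z pays the twist's UPPER half (cycu-p3 §0); descend.
No tower split, no Ko, no NT. CONDITIONAL; closes nothing. [cite: JetchevSkinnerWan2017, Thm. 3.3.1 and §7.4.1 (arXiv:1512.06894 pp. 11, 30)]
[cite: Castella2018, Thm. 2.3 and §5 (5.1)–(5.3)] [cite: GrossZagier1986, Thm. I.(6.3) and V.§2]
[cite: FriedbergHoffstein1995, Thm. B] [cite: Miller2011LMS, Def. 1.1 (arXiv:1010.2431 p. 3)] -/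
theorem lowerHalf_of_restricted_of_valueOdd_of_controlLe_of_rankZeroLeaf (hF : PublishedInputsWildThree)
    (hE' : WildSplitEisensteinInclusionAtThreeRestricted)
    (hVodd : ∀ (W : WeierstrassCurve ℚ) [W.IsElliptic] [W.IsGloballyMinimal] (N : ℕ) [NeZero N] (K : Type) [Field K] [NumberField K] (Dt : Literature.NumberTheory.EllipticCurves.ModularForms.ModularParametrizationData W N) (H : Literature.NumberTheory.EllipticCurves.HeegnerDatum N (NumberField.discr K)) (ι : K →+* ℂ) (P : (W.baseChange K).toAffine.Point), Summit.BirchSwinnertonDyer.Rank1Residual.Additive.ClassO6 W 3 → W.HasSurjectiveModNGaloisRep 3 → W.analyticRank = 1 → W.conductorNorm ℤ = N → Literature.NumberTheory.EllipticCurves.IsImaginaryQuadratic K → Literature.NumberTheory.EllipticCurves.SatisfiesHeegnerHypothesis N K → Odd (NumberField.discr K) → (W.quadraticTwist (NumberField.discr K : ℚ)).entireLFunction 1 ≠ 0 → (WeierstrassCurve.Affine.Point.map ι.toRatAlgHom) P = Literature.NumberTheory.EllipticCurves.ModularForms.heegnerPointComplex Dt H → ¬ IsOfFinAddOrder P → ∀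 (κ : Literature.NumberTheory.EllipticCurves.ZpExtension K 3), κ.IsAnticyclotomic → ∀ (γ : Field.absoluteGaloisGroup K) [Fact (κ.IsTopGenerator γ)] (𝔭 : IsDedekindDomain.HeightOneSpectrum (NumberField.RingOfIntegers K)) (h𝔭 : ((3 : ℕ) : NumberField.RingOfIntegers K) ∈ 𝔭.asIdeal) (he : 𝔭.asIdeal.ramificationIdx (NumberField.RingOfIntegers ℚ) = 1) (hf : 𝔭.asIdeal.inertiaDeg (NumberField.RingOfIntegers ℚ) = 1), ∃ ι' : PadicAlgCl 3 ≃+* ℂ, Summit.BirchSwinnertonDyer.BirchSwinnertonDyer.Theorems.SchneiderFree.BranchInducesPrime 3 ι' 𝔭 ∧ ∃ (ΩK : ℂ) (Ωp : ℂ_[3]) (L : Literature.NumberTheory.EllipticCurves.UnrSeries 3), ΩK ≠ 0 ∧ Ωp ≠ 0 ∧ Literature.NumberTheory.EllipticCurves.IsBDPLFunction ι' 𝔭 κ γ Dt.f ΩK Ωp L ∧ ∃ u : (Literature.NumberTheory.EllipticCurves.unrIntegers 3)ˣ, L.HasValueAt 0 ((((u : Literature.NumberTheory.EllipticCurves.unrIntegers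 3) : Literature.NumberTheory.EllipticCurves.unrIntegers 3) : ℂ_[3]) * (algebraMap ℚ_[3] ℂ_[3] (Summit.BirchSwinnertonDyer.Rank1Residual.X11b.Halves.logOmega W 3 (Summit.BirchSwinnertonDyer.Rank1Residual.X11b.embAt K 3 𝔭 h𝔭 he hf) P / (Dt.c : ℚ_[3]))) ^ 2))
    (hCle : ∀ (W : WeierstrassCurve ℚ) [W.IsElliptic] [W.IsGloballyMinimal] (N : ℕ) [NeZero N] (K : Type) [Field K] [NumberField K] (Dt : Literature.NumberTheory.EllipticCurves.ModularForms.ModularParametrizationData W N) (H : Literature.NumberTheory.EllipticCurves.HeegnerDatum N (NumberField.discr K)) (ι : K →+* ℂ) (P : (W.baseChange K).toAffine.Point), Summit.BirchSwinnertonDyer.Rank1Residual.Additive.ClassO6 W 3 → W.HasSurjectiveModNGaloisRep 3 → W.analyticRank = 1 → W.conductorNorm ℤ = N → Literature.NumberTheory.EllipticCurves.IsImaginaryQuadratic K → Literature.NumberTheory.EllipticCurves.SatisfiesHeegnerHypothesis N K → (W.quadraticTwist (NumberField.discr K : ℚ)).entireLFunction 1 ≠ 0 → (WeierstrassCurve.Affine.Point.map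 ι.toRatAlgHom) P = Literature.NumberTheory.EllipticCurves.ModularForms.heegnerPointComplex Dt H → ¬ IsOfFinAddOrder P → Literature.NumberTheory.EllipticCurves.kolyvagin N W K → ∀ (κ : Literature.NumberTheory.EllipticCurves.ZpExtension K 3), κ.IsAnticyclotomic → ∀ (γ : Field.absoluteGaloisGroup K) [Fact (κ.IsTopGenerator γ)] (𝔭 : IsDedekindDomain.HeightOneSpectrum (NumberField.RingOfIntegers K)) (h𝔭 : ((3 : ℕ) : NumberField.RingOfIntegers K) ∈ 𝔭.asIdeal) (he : 𝔭.asIdeal.ramificationIdx (NumberField.RingOfIntegers ℚ) = 1) (hf : 𝔭.asIdeal.inertiaDeg (NumberField.RingOfIntegers ℚ) = 1), Summit.BirchSwinnertonDyer.BirchSwinnertonDyer.Theorems.SchneiderFreeControlAtoms.AdditiveControlLeOnTreeAt 3 κ 𝔭 γ (Summit.BirchSwinnertonDyer.Rank1Residual.X11b.embAt K 3 𝔭 h𝔭 he hf) 0 P)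
    (hZ : WildRankZeroTwistAtThree)
    (W : WeierstrassCurve ℚ) [W.IsElliptic] [W.IsGloballyMinimal]
    (hO6 : ClassO6 W 3) (hsurj : W.HasSurjectiveModNGaloisRep 3) (hr : W.analyticRank = 1) :
    MissingLowerBoundAt W 3 := by
  obtain ⟨hGZ, hKo, hGZK, hmod, -, -, hGZ73, hFH, hpar, hHP⟩ := hF
  haveI hN0 : NeZero (W.conductorNorm ℤ) := ⟨W.conductorNorm_pos_holds.ne'⟩
  -- (a) DATA. parity: `r_an = 1` is odd, so `w(E) = -1`
  have hw : W.rootNumber = -1 := by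
    rcases W.rootNumber_eq_one_or with h | h
    · exfalso
      have heven : Even W.analyticRank := (hpar W).mpr h
      rw [hr] at heven
      exact Nat.not_even_one heven
    · exact h
  -- Friedberg–Hoffstein with auxiliary modulus `2`: Heegner for `N(E)` and `2` split (so `d_K` is odd)
  obtain ⟨K, _, _, hK, -, hHN, hH2, hLt⟩ := hFH W hw 2 two_ne_zero 0
  have hodd : Odd (NumberField.discr K) := by
    have h8 := Literature.SatisfiesHeegnerHypothesis.discr_emod_eight hK.1 hH2 (dvd_refl 2)
    rw [Int.odd_iff]; omega
  -- `3 ∣ N(E)` (additive) splits in `K`; hence `3 ∤ #𝓞_K^×`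
  have h3N : 3 ∣ W.conductorNorm ℤ :=
    (W.dvd_conductorNorm_iff_not_hasGoodReductionAtPrime 3).mpr (not_good_of_addv W 3 hO6.2.1)
  have hsplit : SplitsIn K 3 := hHN 3 Nat.prime_three h3N
  have hwK : ¬ 3 ∣ Units.torsionOrder K :=
    (X11b.Three.not_dvd_discr_and_not_dvd_torsionOrder_of_heegner hK hHN (by decide) h3N).2
  -- the Heegner point over `K` and its data; non-torsion by Gross–Zagier
  obtain ⟨P, Dt, H, ι, hP⟩ := hHP W K hK hHN
  have hL0 : W.entireLFunction 1 = 0 := entireLFunction_one_eq_zero_of_analyticRank_eq_one hr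
  obtain ⟨-, hderiv⟩ := leadingLCoeff_eq_deriv_of_analyticRank_eq_one hr
  have hLK : LDerivEK W K ≠ 0 := by
    rw [lDerivEK_eq_deriv_mul W K hmod hL0]; exact mul_ne_zero hderiv hLt
  have hnt : ¬ IsOfFinAddOrder P :=
    (lDerivEK_ne_zero_iff_not_isOfFinAddOrder W (W.conductorNorm ℤ) K (hGZ _ W K) hK hHN
      ⟨Dt, H, ι, hP⟩).mp hLK
  -- Kolyvagin: `rank E(K) = 1`, `Ш(E/K)` finite
  obtain ⟨hrk, hfin⟩ := hKo (W.conductorNorm ℤ) W K hK hHN ⟨Dt, H, ι, hP⟩ hnt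
  -- a frame `(κ, γ, 𝔭)` and the other prime `𝔭′ ≠ 𝔭` above `3`
  obtain ⟨κ, γ, -, hκ, hγ, -⟩ := X11b.exists_anticyclotomic_generator_prime (p := 3) hK
  haveI : Fact (κ.IsTopGenerator γ) := ⟨hγ⟩
  obtain ⟨𝔭, h𝔭, he, hf⟩ := X11b.exists_degreeOnePrime_of_splitsIn K 3 hK.1 hsplit
  obtain ⟨𝔭', hne, h𝔭', he', hf'⟩ := X11b.Three.exists_ne_degreeOne_prime hK.1 h𝔭 he hf
  -- (b) PLUMBING. frame AND unit value at `(κ, γ, 𝔭)` over the Friedberg–Hoffstein field (odd `d_K`), from `hVodd`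
  obtain ⟨ι', hind, ΩK, Ωp, L, hΩK, hΩp, hBDP, u, hval⟩ :=
    hVodd W (W.conductorNorm ℤ) K Dt H ι P hO6 hsurj hr rfl hK hHN hodd hLt hP hnt κ hκ γ 𝔭 h𝔭 he hf
  -- the control INEQUALITY at `𝔭′` at slack `0` (CTL₀ included), from `hCle`
  have hctl : SchneiderFreeControlAtoms.AdditiveControlLeOnTreeAt 3 κ 𝔭' γ (embAt K 3 𝔭' h𝔭' he' hf') 0 P :=
    hCle W (W.conductorNorm ℤ) K Dt H ι P hO6 hsurj hr rfl hK hHN hLt hP hnt (hKo _ W K) κ hκ γ 𝔭'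
      h𝔭' he' hf'
  obtain ⟨n, hn, hnle⟩ := hctl
  -- the RESTRICTED EISENSTEIN INCLUSION `Ch_Λ(X_(∅,0))·R₀⟦T⟧ ⊆ (L)` at the frame (crux #2′ BY NAME, fed with the datum,
  -- torsion-guarded by CTL₀)
  have hincl : (XAc.charIdeal (W.baseChange K) 3 κ 𝔭' ∅ γ).map (PowerSeries.map (toUnr 3)) ≤
      Ideal.span {L} :=
    hE' W (W.conductorNorm ℤ) K Dt H ι P hO6 hsurj hr rfl hK hHN hLt hP hnt κ hκ γ 𝔭 h𝔭 he hf 𝔭' h𝔭' hne ι' hind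
      ΩK Ωp L hΩK hΩp hBDP hn.1
  -- the value read through the logarithm at `𝔭′` (rank one: `(log_{𝔭′} P)² = (log_𝔭 P)²`)
  have hval' : L.HasValueAt 0 ((((u : unrIntegers 3) : unrIntegers 3) : ℂ_[3]) *
      (algebraMap ℚ_[3] ℂ_[3]
        (logOmega W 3 (embAt K 3 𝔭' h𝔭' he' hf') P / (Dt.c : ℚ_[3]))) ^ 2) :=
    (SchneiderFreeAdditiveX3.hasValueAt_sq_logOmega_embAt_iff_of_rank_one W 3 hK.1 hrk h𝔭 he hf
      h𝔭' he' hf' P _ _ L).mpr hval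
  -- the LOWER socket at slack `v₃(c)` at the frame `(κ, 𝔭′, γ, embAt 𝔭′)`
  have hc0 : Dt.c ≠ 0 := Dt.maninConstant_ne_zero_holds
  have hlog : logOmega W 3 (embAt K 3 𝔭' h𝔭' he' hf') P ≠ 0 := X11b.R1.logOmega_ne_zero W 3 _ hnt
  have hlow : SchneiderFree.AdditiveIMCLowerBDPOnTreeLeAt 3 κ 𝔭' γ (embAt K 3 𝔭' h𝔭' he' hf')
      (padicValNat 3 Dt.c.natAbs) P := by
    -- the LOWER norm receptacle (`⊆` + value): `2·ord₃(log_{𝔭′}P / c) ≤ ord₃ f(0)`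
    obtain ⟨htors, f, hfI, hf0, hfn⟩ := hn
    have hmem : PowerSeries.map (toUnr 3) f ∈ Ideal.span {L} := by
      have h3 := hincl
      rw [hfI, CongruenceLimit.map_span_singleton_powerSeries] at h3
      exact (Ideal.span_singleton_le_iff_mem _).mp h3
    obtain ⟨-, hle⟩ := Supersingular.two_mul_valuation_le_of_mem_span 3 hf0 hmem u hval'
    have hc0' : (Dt.c : ℚ_[3]) ≠ 0 := by exact_mod_cast hc0
    rw [div_eq_mul_inv, Padic.valuation_mul hlog (inv_ne_zero hc0'), Padic.valuation_inv,
      Padic.valuation_intCast, valuation_logOmega hlog, hfn] at hle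
    refine ⟨n, ⟨htors, f, hfI, hf0, hfn⟩, ?_⟩
    simp only [padicValInt] at hle
    linarith
  -- STEP L at slack `v₃(c)`: the link consumes control ONLY as `≤` (utd-p3 g6, p593079 §3)
  have hlo : SchneiderFree.IndexLowerBoundLeAt W 3 K P (padicValNat 3 Dt.c.natAbs) :=
    AdditiveRankOneControlLe.indexLowerBoundLeAt_of_imcLowerLe_of_controlLe_zero rfl hK hHN hfin hlow
      ⟨n, hn, hnle⟩
  -- (c) a globally minimal model of the twist; its UPPER half from the rank-zero wild leaf
  have hD0 : (NumberField.discr K : ℚ) ≠ 0 := by exact_mod_cast NumberField.discr_ne_zero K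
  haveI : (W.quadraticTwist (NumberField.discr K : ℚ)).IsElliptic := W.isElliptic_quadraticTwist hD0
  obtain ⟨Cd, hCd⟩ := hasGlobalMinimalModel_rat_holds (W.quadraticTwist (NumberField.discr K : ℚ))
  haveI : (Cd • W.quadraticTwist (NumberField.discr K : ℚ)).IsGloballyMinimal := hCd
  have hdup : MissingUpperBoundAt (Cd • W.quadraticTwist (NumberField.discr K : ℚ)) 3 :=
    twist_upperHalf_of_rankZeroLeaf hGZK hZ W hO6 hsurj K hK hodd hHN hLt
      (Cd • W.quadraticTwist (NumberField.discr K : ℚ)) Cd rfl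
  -- JOINT lower half over the pair, then descend with the twist's upper half
  exact missingLowerBoundAt_of_joint_of_upper
    (SchneiderFree.Exact.jointLowerBoundAt_of_stepL_manin hGZ hKo hGZK hmod hGZ73 W 3 (W.conductorNorm ℤ)
      K Dt H ι P (Cd • W.quadraticTwist (NumberField.discr K : ℚ)) hr rfl h3N hK hodd hwK hHN hLt hP
      ⟨Cd, rfl⟩ (by decide) hlo) hdup

/-! ### §2 CU's deciding crux K1 BY NAME — three feeds -/

/-- **K1 `PSRankOneLowerHalfAtThree` (21580) ⟸ PUB ∧ E′ (24155) ∧ V (20385) ∧ C (20386) ∧ Z (20387)** — the pure E ↦ E′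
re-key of cycu-p3 g0's `psRankOneLowerHalfAtThree_of_soed` (feeds `valueOdd_of_waldspurger`, `controlLe_of_control`, p595286).
K1's principal-series binders and `¬ HasCM` are idle. CONDITIONAL cross-route kernel; closes nothing; BSD is not proved by
this. [cite: JetchevSkinnerWan2017, §7.4.1 (arXiv:1512.06894 p. 30)] -/
theorem psRankOneLowerHalfAtThree_of_restricted_of_waldspurger_of_control (hF : PublishedInputsWildThree)
    (hE' : WildSplitEisensteinInclusionAtThreeRestricted) (hV : WildSplitWaldspurgerAtThree)
    (hC : WildSplitControlAtThree) (hZ : WildRankZeroTwistAtThree) :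
    Summit.BirchSwinnertonDyer.BirchSwinnertonDyer.Theses.CyclotomicUntwist.PSRankOneLowerHalfAtThree := by
  intro W _ _ _hncm hO6 hsurj _hev _hsq hr
  exact lowerHalf_of_restricted_of_valueOdd_of_controlLe_of_rankZeroLeaf hF hE' (valueOdd_of_waldspurger hV)
    (controlLe_of_control hC) hZ W hO6 hsurj hr

/-- **K1 ⟸ PUB ∧ E′ ∧ V ∧ PT1 (item 20461's text) ∧ Z** — crux #5 replaced by Poitou–Tate duality for Selmer structures
ALONE (feed `controlLe_of_poitouTate`, p595286 over p593079 §2). CONDITIONAL; closes nothing.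
[cite: MilneADT2006, Ch. I, Thm. 4.10(b)] [cite: JetchevSkinnerWan2017, Thm. 3.3.1 and §7.4.1 (arXiv:1512.06894 pp. 11, 30)] -/
theorem psRankOneLowerHalfAtThree_of_restricted_of_waldspurger_of_poitouTate (hF : PublishedInputsWildThree)
    (hE' : WildSplitEisensteinInclusionAtThreeRestricted) (hV : WildSplitWaldspurgerAtThree)
    (hPT : ∀ (K : Type) [Field K] [NumberField K], Literature.NumberTheory.GaloisCohomology.poitouTate_selmerStructure_duality K)
    (hZ : WildRankZeroTwistAtThree) :
    Summit.BirchSwinnertonDyer.BirchSwinnertonDyer.Theses.CyclotomicUntwist.PSRankOneLowerHalfAtThree := by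
  intro W _ _ _hncm hO6 hsurj _hev _hsq hr
  exact lowerHalf_of_restricted_of_valueOdd_of_controlLe_of_rankZeroLeaf hF hE' (valueOdd_of_waldspurger hV)
    (controlLe_of_poitouTate hPT) hZ W hO6 hsurj hr

/-- **K1 ⟸ PUB ∧ E′ ∧ LZZ (item 20316's fact) ∧ [one `R₀`-frame at odd `d_K`: item 20928's text + `Odd (discr K)`] ∧ PT1 ∧
Z** — both shared cruxes #4/#5 replaced by their cheap suppliers (feeds `valueOdd_of_lzz_of_frameOdd`, `controlLe_of_poitouTate`,
p595286). So, on the onto wild rank-one rows, CU's K1 and SOED's lower half hang on the SAME research set {E′, Z} + {frame at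
odd d_K (print + port)} + refereed facts. CONDITIONAL; closes nothing; BSD is not proved by this.
[cite: JetchevSkinnerWan2017, §7.4.1 (arXiv:1512.06894 p. 30)] [cite: LiuZhangZhang2018, Thm 1.5.1 and Thm 1.5.3]
[cite: MilneADT2006, Ch. I, Thm. 4.10(b)] -/
theorem psRankOneLowerHalfAtThree_of_restricted_of_frameOdd_of_poitouTate (hF : PublishedInputsWildThree)
    (hE' : WildSplitEisensteinInclusionAtThreeRestricted)
    (hLZZ : thm151_thm153_modularCurve_heegnerVector_additive)
    (hFr : ∀ (W : WeierstrassCurve ℚ) [W.IsElliptic] [W.IsGloballyMinimal] (N : ℕ) [NeZero N] (K : Type) [Field K] [NumberField K] (Dt : Literature.NumberTheory.EllipticCurves.ModularForms.ModularParametrizationData W N), Summit.BirchSwinnertonDyer.Rank1Residual.Additive.ClassO6 W 3 → W.conductorNorm ℤ = N → Literature.NumberTheory.EllipticCurves.IsImaginaryQuadratic K → Literature.NumberTheory.EllipticCurves.SatisfiesHeegnerHypothesis N K → Odd (NumberField.discr K) → ∀ (κ : Literature.NumberTheory.EllipticCurves.ZpExtension K 3), κ.IsAnticyclotomic → ∀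 (γ : Field.absoluteGaloisGroup K) [Fact (κ.IsTopGenerator γ)] (𝔭 : IsDedekindDomain.HeightOneSpectrum (NumberField.RingOfIntegers K)), ((3 : ℕ) : NumberField.RingOfIntegers K) ∈ 𝔭.asIdeal → ∃ ι' : PadicAlgCl 3 ≃+* ℂ, Summit.BirchSwinnertonDyer.BirchSwinnertonDyer.Theorems.SchneiderFree.BranchInducesPrime 3 ι' 𝔭 ∧ ∃ (ΩK : ℂ) (Ωp : ℂ_[3]) (L : Literature.NumberTheory.EllipticCurves.UnrSeries 3), ΩK ≠ 0 ∧ Ωp ≠ 0 ∧ Literature.NumberTheory.EllipticCurves.IsBDPLFunction ι' 𝔭 κ γ Dt.f ΩK Ωp L)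
    (hPT : ∀ (K : Type) [Field K] [NumberField K], Literature.NumberTheory.GaloisCohomology.poitouTate_selmerStructure_duality K)
    (hZ : WildRankZeroTwistAtThree) :
    Summit.BirchSwinnertonDyer.BirchSwinnertonDyer.Theses.CyclotomicUntwist.PSRankOneLowerHalfAtThree := by
  intro W _ _ _hncm hO6 hsurj _hev _hsq hr
  exact lowerHalf_of_restricted_of_valueOdd_of_controlLe_of_rankZeroLeaf hF hE' (valueOdd_of_lzz_of_frameOdd hLZZ hFr)
    (controlLe_of_poitouTate hPT) hZ W hO6 hsurj hr

end Summit.BirchSwinnertonDyer.BirchSwinnertonDyer.Theorems.CyclotomicUntwistOfSOEDRestricted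

end
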